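import Summits.BirchSwinnertonDyer.BirchSwinnertonDyer.Theorems.KimAtThreeSemiLocalTraceDual
import HarnessLib

/-!
# Route `KimAtThreeKolyvagin` (W2): the SHARP trace dual of `ℤ[ζ_m]` at a wild level `m = 3m′` —
# `m′·(1 − ζ^{m′})·ℤ[ζ_m]^∨ ⊆ ℤ[ζ_m]`, i.e. the inverse different costs only the uniformiser `1 − ζ₃` above `3`
# (the global input of the wild weight `θ_r = 1 − ζ₃` of the shallow package (C1ₑₓʷ); items 19599 · 19077)

Cell `bsd-addord`, seat `bsd-addord-w2-c4` (gen 11).  `--supports` 19077 (helper).  TOOL theorems only (no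
definition, no named fact, no instance, no `sorry`); nothing about any curve; nothing booked; BSD is not proved by
any of this.  Credit: the template is seat w2-acc3 gen 5's `KimAtThreeSemiLocalTraceDual` §1–§2
(`m·ℤ[ζ_m]^∨ ⊆ ℤ[ζ_m]` from Mathlib's `traceForm_dualSubmodule_adjoin`, `ℤ[ζ]^∨ = Φ_m′(ζ)⁻¹·ℤ[ζ]`, and
`m = Φ_m′(ζ)·q`).

WHY.  This seat's weighted compatibility (`KimAtThreeShallowEqDeepRiderOfWeightedCompat`, memo
HOME/w2c4/W2C4-WEIGHTED-COMPAT-g11.md §3 (W)) needs, at a WILD cyclotomic level `m = 3m′` and a place `w ∣ 3` of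
`ℚ(ζ_m)` (tamely ramified, `e = 2`), the per-completion bound `Tr_{L_w/ℚ₃}(x·𝒪_w) ⊆ ℤ₃ ⇒ (1 − ζ₃)·x ∈ 𝒪_w` —
the inverse different of `L_w/ℚ₃` is `(1 − ζ₃)⁻¹𝒪_w` — whereas w2-acc3's
`pow_padicValNat_mul_mem_adicCompletionIntegers_of_forall_trace_mul_mem` gives only `3·x ∈ 𝒪_w` there.  THIS FILE
proves the sharp GLOBAL statement from which that bound follows by w2-acc3's semi-local / per-completion transport
(their §3–§4, `…TraceDualLevel`, `…TraceDualLocal`, with the multiplier `m` replaced by `m′(1 − ζ^{m′})`, `m′` a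
`3`-adic unit):
* §1 `exists_mul_one_sub_pow_eq_aeval_derivative_mul` — for a primitive `m`-th root of unity `ζ`, `m = 3m′`:
  **`m′·(1 − ζ^{m′}) = Φ_m′(ζ)·q` with `q ∈ ℤ[ζ]`**.  Proof: `H := X^{2m′} + X^{m′} + 1 = (X^m − 1)/(X^{m′} − 1)`
  is divisible by `Φ_m` in `ℤ[X]` (Mathlib `X_pow_sub_one_mul_cyclotomic_dvd_X_pow_sub_one_of_dvd`, cancel
  `X^{m′} − 1`), `H = Φ_m·S`; differentiate and evaluate at `ζ` (`Φ_m(ζ) = 0`): `H′(ζ) = Φ_m′(ζ)·S(ζ)` with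
  `H′(ζ)·ζ^{m′+1} = 2m′ζ^{3m′} + m′ζ^{2m′} = m′(2 + ω²) = m′(1 − ω)` for `ω := ζ^{m′}` (`1 + ω + ω² = 0`).
* §2 `exists_mem_adjoin_mul_eq_of_forall_trace_mul_mem_of_eq_three_mul` — **if `y ∈ ℚ(ζ_m)` has
  `Tr(y·z) ∈ ℤ` for all `z ∈ ℤ[ζ_m]` then `m′(1 − ζ^{m′})·y ∈ ℤ[ζ_m]`** (w2-acc3's §2 verbatim on §1);
  `exists_wild_mul_traceDual_eq` — the trace-dual basis vectors `d_i` have `m′(1 − ζ^{m′})·d_i ∈ ℤ[ζ]`.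
* §3 `wild_mul_mem_span_ringOfIntegers_of_norm_trace_mul_le_one` (any `p`) — the SEMI-LOCAL form:
  `‖Tr(a·(1 ⊗ 𝓞))‖ ≤ 1 ⇒ (1 ⊗ m′(1 − ζ^{m′}))·a ∈ L_int′(m) = ℤ_p⟨1 ⊗ 𝓞⟩` (twin of w2-acc3's §3).
So `𝒟_{ℚ(ζ_m)} ⊇ (m′(1 − ζ₃))` on the power order `ℤ[ζ_m]`: localised at `w ∣ 3` this is `𝒪_w^∨ ⊆ (1 − ζ₃)⁻¹𝒪_w`.

References: J.-P. Serre, *Local Fields* (1979) III §3, §6 (different and tame ramification) [SerreLocalFields1979];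
J. Neukirch, *Algebraic Number Theory* III (2.4)–(2.9) [folklore]; [CasselsFrohlichANT1967] Ch. I §4;
L. Washington, *Cyclotomic Fields* Prop. 2.7 (`Φ_m` and `X^m − 1`) [folklore]; memo W2C4-WEIGHTED-COMPAT-g11 §3.
-/

set_option autoImplicit false
-- the Theorems namespace of a single-conjunct summit repeats the summit name by design (D-0017)
set_option linter.dupNamespace false
-- `CyclotomicField m ℚ`'s two `ℚ`-algebra structures agree only up to unfolding (as in w2-acc3's sibling files)
set_option backward.isDefEq.respectTransparency false

noncomputable section

open scoped TensorProduct NumberField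
open NumberField Polynomial IsDedekindDomain
open Summit.BirchSwinnertonDyer.BirchSwinnertonDyer.Theorems.KimAtThreePortSharedSATCore
open Summit.BirchSwinnertonDyer.BirchSwinnertonDyer.Theorems.KimAtThreeSemiLocalTraceDual

namespace Summit.BirchSwinnertonDyer.BirchSwinnertonDyer.Theorems.KimAtThreeShallowEqDeepWildDifferent

/-! ### §1 `m′·(1 − ζ^{m′}) ∈ Φ_m′(ζ)·ℤ[ζ]` for `m = 3m′` -/

/-- **`m′·(1 − ζ^{m′}) = Φ_m′(ζ)·q` with `q ∈ ℤ[ζ]`** for a primitive `m`-th root of unity `ζ`, `m = 3m′`, in a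
field of characteristic `0` (`Φ_m = minpoly ℚ ζ`): differentiate `X^{2m′} + X^{m′} + 1 = Φ_m·S` and evaluate at
`ζ`; `(2m′ζ^{2m′−1} + m′ζ^{m′−1})·ζ^{m′+1} = m′(2 + ζ^{2m′}) = m′(1 − ζ^{m′})` by `1 + ζ^{m′} + ζ^{2m′} = 0`.
[folklore] -/
theorem exists_mul_one_sub_pow_eq_aeval_derivative_mul {K : Type*} [Field K] [CharZero K]
    {m m' : ℕ} (hm : m = 3 * m') (hm' : 0 < m') {ζ : K} (hζ : IsPrimitiveRoot ζ m) :
    ∃ q ∈ Algebra.adjoin ℤ {ζ}, (m' : K) * (1 - ζ ^ m') = aeval ζ (derivative (minpoly ℚ ζ)) * q := by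
  have hmpos : 0 < m := by omega
  -- `Φ_m′(ζ)` computed from the integral cyclotomic polynomial
  have hmin : minpoly ℚ ζ = map (Int.castRingHom ℚ) (cyclotomic m ℤ) := by
    rw [map_cyclotomic_int, cyclotomic_eq_minpoly_rat hζ hmpos]
  have hder : aeval ζ (derivative (minpoly ℚ ζ)) = aeval ζ (derivative (cyclotomic m ℤ)) := by
    rw [hmin, derivative_map, ← algebraMap_int_eq, aeval_map_algebraMap]
  have hΦ : aeval ζ (cyclotomic m ℤ) = 0 := by
    have h0 := minpoly.aeval ℚ ζ
    rwa [hmin, ← algebraMap_int_eq, aeval_map_algebraMap] at h0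
  -- `H := X^{2m′} + X^{m′} + 1` is divisible by `Φ_m`: `(X^{m′} − 1)·Φ_m ∣ X^m − 1 = (X^{m′} − 1)·H`
  set H : ℤ[X] := X ^ (2 * m') + X ^ m' + 1 with hH
  have hfac : (X ^ m - 1 : ℤ[X]) = (X ^ m' - 1) * H := by
    rw [hH, hm]; ring
  have hdiv : (X ^ m' - 1 : ℤ[X]) * cyclotomic m ℤ ∣ (X ^ m' - 1) * H := by
    rw [← hfac]
    refine X_pow_sub_one_mul_cyclotomic_dvd_X_pow_sub_one_of_dvd ℤ ?_
    rw [Nat.mem_properDivisors]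
    exact ⟨⟨3, by rw [hm, mul_comm]⟩, by omega⟩
  have hne : (X ^ m' - 1 : ℤ[X]) ≠ 0 := by
    rw [← C_1]; exact X_pow_sub_C_ne_zero hm' 1
  obtain ⟨S, hS⟩ := (mul_dvd_mul_iff_left hne).mp hdiv
  -- differentiate `H = Φ_m * S` and evaluate at `ζ`
  have hD : derivative H = derivative (cyclotomic m ℤ) * S + cyclotomic m ℤ * derivative S := by
    rw [hS, derivative_mul]
  have hD' : aeval ζ (derivative H) = aeval ζ (derivative (cyclotomic m ℤ)) * aeval ζ S := by
    have := congr_arg (aeval ζ) hD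
    simp only [map_add, map_mul, hΦ, zero_mul, add_zero] at this
    exact this
  have hDH : aeval ζ (derivative H) = (2 * m' : ℕ) * ζ ^ (2 * m' - 1) + (m' : ℕ) * ζ ^ (m' - 1) := by
    rw [hH]
    simp only [derivative_X_pow, derivative_one, add_zero, map_add, map_mul, map_natCast, map_pow, aeval_X]
  -- the cube root of unity `ω := ζ^{m′}`
  have hω : IsPrimitiveRoot (ζ ^ m') 3 := hζ.pow hmpos (by rw [hm, mul_comm])
  have h3 : (ζ ^ m') ^ 3 = 1 := hω.pow_eq_one
  have hs : 1 + ζ ^ m' + (ζ ^ m') ^ 2 = 0 := by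
    have := hω.geom_sum_eq_zero (by norm_num : 1 < 3)
    simpa [Finset.sum_range_succ, add_assoc] using this
  refine ⟨aeval ζ S * ζ ^ (m' + 1), ?_, ?_⟩
  · exact Subalgebra.mul_mem _ (Polynomial.aeval_mem_adjoin_singleton ℤ ζ)
      (Subalgebra.pow_mem _ (Algebra.self_mem_adjoin_singleton ℤ ζ) _)
  · -- `Φ′(ζ)·S(ζ)·ζ^{m′+1} = H′(ζ)·ζ^{m′+1} = 2m′ζ^{3m′} + m′ζ^{2m′} = m′(1 − ζ^{m′})`
    rw [hder, ← mul_assoc, ← hD', hDH]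
    have h1 : ζ ^ (2 * m' - 1) * ζ ^ (m' + 1) = (ζ ^ m') ^ 3 := by
      rw [← pow_add, ← pow_mul]; congr 1; omega
    have h2 : ζ ^ (m' - 1) * ζ ^ (m' + 1) = (ζ ^ m') ^ 2 := by
      rw [← pow_add, ← pow_mul]; congr 1; omega
    have key : ((2 * m' : ℕ) * ζ ^ (2 * m' - 1) + (m' : ℕ) * ζ ^ (m' - 1)) * ζ ^ (m' + 1) =
        (m' : K) * (2 * (ζ ^ m') ^ 3 + (ζ ^ m') ^ 2) := by
      rw [add_mul, mul_assoc, h1, mul_assoc, h2]; push_cast; ring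
    rw [key, h3]
    linear_combination (-(m' : K)) * hs

/-! ### §2 `m′·(1 − ζ^{m′})·ℤ[ζ_m]^∨ ⊆ ℤ[ζ_m]` (the trace dual over `ℚ`) -/

/-- **The sharp dual at a wild level**: for `m = 3m′`, a primitive `m`-th root of unity `ζ` generating the
cyclotomic field `K = ℚ(ζ_m)`, and `y ∈ K` with `Tr_{K/ℚ}(y·z) ∈ ℤ` for every `z ∈ ℤ[ζ]`: `m′(1 − ζ^{m′})·y ∈ ℤ[ζ]`
(Mathlib `traceForm_dualSubmodule_adjoin`: `ℤ[ζ]^∨ = Φ_m′(ζ)⁻¹·ℤ[ζ]`, and §1).  With `𝓞_K = ℤ[ζ]` this says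
`m′(1 − ζ^{m′}) ∈ 𝒟_{K/ℚ}`; above `3` (where `m′` is a unit) the inverse different costs only the uniformiser
`1 − ζ₃`, `ζ₃ = ζ^{m′}`. [cite: SerreLocalFields1979, Ch. III §6, Prop. 13] -/
theorem exists_mem_adjoin_mul_eq_of_forall_trace_mul_mem_of_eq_three_mul {K : Type*} [Field K] [NumberField K]
    {m m' : ℕ} [NeZero m] [IsCyclotomicExtension {m} ℚ K] (hm : m = 3 * m') {ζ : K} (hζ : IsPrimitiveRoot ζ m)
    {y : K} (hy : ∀ z ∈ Algebra.adjoin ℤ {ζ}, ∃ n : ℤ, (n : ℚ) = Algebra.trace ℚ K (y * z)) :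
    ∃ z ∈ Algebra.adjoin ℤ {ζ}, (m' : K) * (1 - ζ ^ m') * y = z := by
  have hmpos : 0 < m := Nat.pos_of_ne_zero (NeZero.ne m)
  have hm' : 0 < m' := by
    rcases Nat.eq_zero_or_pos m' with h | h
    · rw [h, mul_zero] at hm; omega
    · exact h
  have htop : Algebra.adjoin ℚ {ζ} = ⊤ := IsCyclotomicExtension.adjoin_primitive_root_eq_top hζ
  have hint : IsIntegral ℤ ζ := hζ.isIntegral hmpos
  have hdual := traceForm_dualSubmodule_adjoin ℤ ℚ (L := K) htop hint
  have hmem : y ∈ (Algebra.traceForm ℚ K).dualSubmodule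
      (Subalgebra.toSubmodule (Algebra.adjoin ℤ {ζ})) := by
    rw [LinearMap.BilinForm.mem_dualSubmodule]
    intro z hz
    obtain ⟨n, hn⟩ := hy z hz
    rw [Algebra.traceForm_apply, Submodule.mem_one]
    exact ⟨n, by simpa using hn⟩
  rw [hdual, Submodule.mem_smul_pointwise_iff_exists] at hmem
  obtain ⟨z, hz, rfl⟩ := hmem
  obtain ⟨q, hq, hmq⟩ := exists_mul_one_sub_pow_eq_aeval_derivative_mul hm hm' hζ
  have hne := aeval_derivative_minpoly_ne_zero m hζ
  refine ⟨q * z, Subalgebra.mul_mem _ hq hz, ?_⟩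
  rw [hmq, smul_eq_mul, mul_assoc, mul_left_comm, mul_inv_cancel_left₀ hne]


/-- **The trace-dual basis vectors `d_i` of the power basis `{ζ^i}` have `m′(1 − ζ^{m′})·d_i ∈ ℤ[ζ]`** at a
wild level `m = 3m′` (they lie in `ℤ[ζ]^∨`; §2) — the sharp twin of w2-acc3's `exists_natCast_mul_traceDual_eq`.
[folklore] -/
theorem exists_wild_mul_traceDual_eq {K : Type*} [Field K] [NumberField K]
    {m m' : ℕ} [NeZero m] [IsCyclotomicExtension {m} ℚ K] (hm : m = 3 * m') {ζ : K} (hζ : IsPrimitiveRoot ζ m)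
    (i : Fin (IsPrimitiveRoot.powerBasis ℚ hζ).dim) :
    ∃ z ∈ Algebra.adjoin ℤ {ζ},
      (m' : K) * (1 - ζ ^ m') * (IsPrimitiveRoot.powerBasis ℚ hζ).basis.traceDual i = z := by
  classical
  refine exists_mem_adjoin_mul_eq_of_forall_trace_mul_mem_of_eq_three_mul hm hζ fun z hz => ?_
  have hmem : (IsPrimitiveRoot.powerBasis ℚ hζ).basis.traceDual i ∈
      (Algebra.traceForm ℚ K).dualSubmodule (Subalgebra.toSubmodule (Algebra.adjoin ℤ {ζ})) := by
    rw [toSubmodule_adjoin_eq_span_range_basis m hζ,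
      LinearMap.BilinForm.dualSubmodule_span_of_basis _ (traceForm_nondegenerate ℚ K),
      Module.Basis.traceDual_def]
    exact Submodule.subset_span ⟨i, rfl⟩
  rw [LinearMap.BilinForm.mem_dualSubmodule] at hmem
  obtain ⟨n, hn⟩ := (Submodule.mem_one).mp (hmem z hz)
  exact ⟨n, by simpa [Algebra.traceForm_apply] using hn⟩

/-! ### §3 The semi-local form in `ℚ_p ⊗_ℚ ℚ(ζ_m)`: `(1 ⊗ m′(1 − ζ^{m′}))·L_int′(m)^∨ ⊆ L_int′(m)` -/

/-- **`(1 ⊗ m′(1 − ζ^{m′}))·L_int′(m)^∨ ⊆ L_int′(m)`** (any prime `p`, `m = 3m′`): if `a ∈ ℚ_p ⊗ ℚ(ζ_m)` has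
`‖Tr_{(ℚ_p ⊗ ℚ(ζ_m))/ℚ_p}(a·(1 ⊗ b))‖ ≤ 1` for every `b ∈ 𝓞_{ℚ(ζ_m)}`, then
`(1 ⊗ m′(1 − ζ_m^{m′}))·a ∈ L_int′(m) = ℤ_p⟨1 ⊗ 𝓞⟩` — the sharp twin of w2-acc3's
`natCast_smul_mem_span_ringOfIntegers_of_norm_trace_mul_le_one` (`m·a ∈ L_int′(m)`), same proof: expand `a` in
the base change `1 ⊗ d_i` of the trace-dual basis (coordinates = the traces against `1 ⊗ ζ^i`, in `ℤ_p`) and use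
`m′(1 − ζ^{m′})·d_i ∈ ℤ[ζ] ⊆ 𝓞`.  At `p = 3` (`m′ ∈ ℤ₃ˣ`) this is the semi-local shape of the wild weight: the
per-completion reading `Tr_{L_w/ℚ₃}(x·𝒪_w) ⊆ ℤ₃ ⇒ (1 − ζ₃)·x ∈ 𝒪_w` follows by w2-acc3's transport
(`…SemiLocalTraceDualLevel` / `…Local`). [cite: Kim2022StructureSelmer, §3.4.1 (the lattice `ℤ_p ⊗ 𝓞` of the semi-local `exp*`)] -/
theorem wild_mul_mem_span_ringOfIntegers_of_norm_trace_mul_le_one (p : ℕ) [Fact p.Prime]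
    {m m' : ℕ} [NeZero m] (hm : m = 3 * m') {a : ℚ_[p] ⊗[ℚ] CyclotomicField m ℚ}
    (ha : ∀ b : 𝓞 (CyclotomicField m ℚ),
      ‖Algebra.trace ℚ_[p] (ℚ_[p] ⊗[ℚ] CyclotomicField m ℚ)
          (a * ((1 : ℚ_[p]) ⊗ₜ[ℚ] (b : CyclotomicField m ℚ)))‖ ≤ 1) :
    ((1 : ℚ_[p]) ⊗ₜ[ℚ] ((m' : CyclotomicField m ℚ) *
        (1 - IsCyclotomicExtension.zeta m ℚ (CyclotomicField m ℚ) ^ m'))) * a ∈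
      Submodule.span ℤ_[p]
        (Set.range fun b : 𝓞 (CyclotomicField m ℚ) ↦ (1 : ℚ_[p]) ⊗ₜ[ℚ] (b : CyclotomicField m ℚ)) := by
  classical
  have hmpos : 0 < m := Nat.pos_of_ne_zero (NeZero.ne m)
  have hζ := IsCyclotomicExtension.zeta_spec m ℚ (CyclotomicField m ℚ)
  set ζ := IsCyclotomicExtension.zeta m ℚ (CyclotomicField m ℚ) with hζdef
  set c : CyclotomicField m ℚ := (m' : CyclotomicField m ℚ) * (1 - ζ ^ m') with hc
  set pb : PowerBasis ℚ (CyclotomicField m ℚ) := IsPrimitiveRoot.powerBasis ℚ hζ with hpb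
  have hgen : pb.gen = ζ := IsPrimitiveRoot.powerBasis_gen ℚ hζ
  set d : Module.Basis (Fin pb.dim) ℚ (CyclotomicField m ℚ) := pb.basis.traceDual with hd
  set f : Module.Basis (Fin pb.dim) ℚ_[p] (ℚ_[p] ⊗[ℚ] CyclotomicField m ℚ) :=
    Algebra.TensorProduct.basis ℚ_[p] d with hf
  -- the coordinates of `a` in the basis `f = 1 ⊗ d` are the traces against `1 ⊗ ζ^i`
  have htr : ∀ i j : Fin pb.dim,
      Algebra.trace ℚ_[p] (ℚ_[p] ⊗[ℚ] CyclotomicField m ℚ) (f j * ((1 : ℚ_[p]) ⊗ₜ[ℚ] (ζ ^ (i : ℕ)))) =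
        if i = j then 1 else 0 := by
    intro i j
    rw [hf, Algebra.TensorProduct.basis_apply, Algebra.TensorProduct.tmul_mul_tmul, one_mul,
      trace_one_tmul, hd]
    have hb : ζ ^ (i : ℕ) = pb.basis i := by rw [pb.coe_basis, hgen]
    rw [hb, Module.Basis.trace_traceDual_mul]
    split_ifs <;> simp
  have hcoord : ∀ i : Fin pb.dim, f.repr a i =
      Algebra.trace ℚ_[p] (ℚ_[p] ⊗[ℚ] CyclotomicField m ℚ) (a * ((1 : ℚ_[p]) ⊗ₜ[ℚ] (ζ ^ (i : ℕ)))) := by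
    intro i
    conv_rhs => rw [← f.sum_repr a]
    rw [Finset.sum_mul, map_sum]
    simp_rw [smul_mul_assoc, map_smul, htr, smul_eq_mul, mul_ite, mul_one, mul_zero]
    rw [Finset.sum_ite_eq]
    simp
  -- `(1 ⊗ c) * (1 ⊗ d_i) = 1 ⊗ (c·d_i)` lies in `L_int′(m)`
  have hmf : ∀ i : Fin pb.dim, ((1 : ℚ_[p]) ⊗ₜ[ℚ] c) * f i ∈ Submodule.span ℤ_[p]
      (Set.range fun b : 𝓞 (CyclotomicField m ℚ) ↦ (1 : ℚ_[p]) ⊗ₜ[ℚ] (b : CyclotomicField m ℚ)) := by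
    intro i
    obtain ⟨z, hz, hzeq⟩ := exists_wild_mul_traceDual_eq hm hζ i
    have hzint : z ∈ integralClosure ℤ (CyclotomicField m ℚ) :=
      adjoin_le_integralClosure (hζ.isIntegral hmpos) hz
    refine Submodule.subset_span ⟨⟨z, hzint⟩, ?_⟩
    change (1 : ℚ_[p]) ⊗ₜ[ℚ] z = ((1 : ℚ_[p]) ⊗ₜ[ℚ] c) * f i
    have hdi : d i = (IsPrimitiveRoot.powerBasis ℚ hζ).basis.traceDual i := rfl
    rw [hf, Algebra.TensorProduct.basis_apply, Algebra.TensorProduct.tmul_mul_tmul, one_mul, ← hzeq, ← hdi, hc]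
  -- assemble
  rw [← f.sum_repr a, Finset.mul_sum]
  refine Submodule.sum_mem _ fun i _ => ?_
  rw [mul_smul_comm]
  obtain ⟨r, hr⟩ := exists_padicInt_coe_eq_of_norm_le_one (p := p) (x := f.repr a i) (by
    rw [hcoord]
    have hζi : ζ ^ (i : ℕ) ∈ integralClosure ℤ (CyclotomicField m ℚ) :=
      (mem_integralClosure_iff ℤ (CyclotomicField m ℚ)).mpr ((hζ.isIntegral hmpos).pow _)
    exact ha ⟨ζ ^ (i : ℕ), hζi⟩)
  rw [← hr, ← padicInt_smul_eq_coe_smul]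
  exact Submodule.smul_mem _ r (hmf i)

end Summit.BirchSwinnertonDyer.BirchSwinnertonDyer.Theorems.KimAtThreeShallowEqDeepWildDifferent

end
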